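import Summits.QuantumFields.BalabanUV.Beta.GAN24.CombContactGaugeStaircaseCauchyPack
import Summits.QuantumFields.BalabanUV.Beta.GAN24.CombContactRefinePWeights
import Summits.QuantumFields.BalabanUV.Beta.GAN24.ContactRefinePThree

/-!
# `BalabanUV.Beta.GAN24.CombContactRefinePThree` — row G-an2-4 ∕ (CONV-C), TRANSFER-III, (III′) S-slot (b), the Wilson contact RATE END `hCTd′`, step CT-4c-P AT THE COMB CHART:
# **THE P-ATOM OF THE (III′) CELLS — tent × conjugated gauge reading × conjugated gauge jump — DIFFERENCED ACROSS TWO CONSECUTIVE TOWERS, PARAMETRICALLY AT ONE RATE** — the (III′) twin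
# of road-P2 g34's `ContactRefinePThree`: road-P2's generic `ContactRefineP.abs_pairing_refine_le` fed with MY `CombContactGaugeStaircaseCauchy(Pack)` identities ∕ letters (the
# `(k+3)`-staircases `ΔG′` with TWO finest spikes, `Gup′`, tower `k+1`'s and tower `k`'s clean-index staircases) and MY two-spike weight rows `CombContactRefinePWeights`.

NOT IN PRINT; OUR BOOKKEEPING (leaf prover `b2b-balaban-gan24-formalise-leaf-01` gen 89; road-P2's (E) text transformed BY NAME: `λ ↦ λ′`, staircase lengths `+1`, letters `αP ↦ (8LcC + F·c₁·C)·N′⁻⁵`,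
`α_cθ^k ↦ (8Lc + F·c₁)·cθ^k·N′⁻⁵`, the spike profile `aΔ′ = [s=0]·8LcC·N′⁻⁵ + [s=1]·(8Lc·cθ^k·N′⁻⁵·Lc + F·c₁·C·N′⁻⁵) + [s≥2]·α_cθ·Lc^s`; [folklore]; 0 `def`, 0 cited facts, 0 `def … : Prop`, 0 sorry).
HONEST FRAMING (verbatim): «discharging `BetaPertH` makes Bałaban's UV stability UNCONDITIONAL — a real constructive-QFT result; it is NOT the continuum limit and NOT the Clay problem.»
HONEST DEPENDENCY (verbatim): «continuum YM on T⁴ ⇐ BetaPertH ∧ nine spine estimates (0/9 proved); BetaPertH ⇐ (D1) ∧ (D4) ∧ CAP+tail; G-an2-4 gates asym, D1 and NE2/3/4.»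
**`abs_pairingAtom_refine_le`** (PARAMETRIC in (N1) `C, κ₀`, CT-4a `c, θ`, I1 `Φ₀` + tent, CT-4d `ε`, face `F`).  Discharges NOTHING of `hCTd′` by itself; NEVER «G-an2-4 closed» as (CONV-C);
NOT D1, NOT BetaPertH, NOT continuum, NOT Clay.  2026-08-28; no existing file touched.
-/

noncomputable section

open Finset
open scoped BigOperators
open Literature.MathematicalPhysics.QuantumFieldTheory
open Literature.MathematicalPhysics.QuantumFieldTheory.LatticeForm (quo)
open Literature.MathematicalPhysics.QuantumFieldTheory.Balaban1983to89
open Literature.MathematicalPhysics.QuantumFieldTheory.Balaban1983to89.Beta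
open B4ContourShift (supNorm supNorm_nonneg)
open ExpKernelCalculus (Zl Zl_nonneg)
open KernelSpecInstance (wΦ)
open AffineAveraging (Form0 Form1 Site box toSite unitVec)
open AffineReproduction (contourSumAdj)
open AveragingContours (blk)
open KKTFluctuationKernel (delta1)
open BalabanCompositeJets (respStep)
open Summit.QuantumFields.BalabanUV.Beta.AxialProjectorBlockMean (bmGaugeAt)
open Summit.QuantumFields.BalabanUV.Beta.GAN24.RespStepBmDecompLegs (legAct)
open Summit.QuantumFields.BalabanUV.Beta.GAN24.RespStepBmDecompPsi (Psi)
open Summit.QuantumFields.BalabanUV.Beta.GAN24.StaircaseFaces (blk_one)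
open Summit.QuantumFields.BalabanUV.Beta.GAN24.StaircasePairing (sum_weights_le_of_geometric)
open Summit.QuantumFields.BalabanUV.Beta.GAN24.ContactOneGaugeCellBound (tsum_env3_le)
open Summit.QuantumFields.BalabanUV.Beta.SymCorrectorForms (zetaS)
open Summit.QuantumFields.BalabanUV.Beta.SymCorrectorFace (faceWtSum faceWtSum_nonneg)
open Summit.QuantumFields.BalabanUV.Beta.GAN24.Push4Iter (legChain)
open Summit.QuantumFields.BalabanUV.Beta.GAN24.RespStepBmDecompExact (respStepBmSeq)
open Summit.QuantumFields.BalabanUV.Beta.GAN24.CombLegChainGauge (PsiFace)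
open Summit.QuantumFields.BalabanUV.Beta.GAN24.CombContactGaugeStaircaseCauchy (combGauge_eq_staircase_zero combGauge_refine_eq_staircase combGauge_coarse_eq_staircase_fine)
open Summit.QuantumFields.BalabanUV.Beta.GAN24.CombContactGaugeStaircaseCauchyPack (abs_combPieceDiff_le abs_combPieceDiff_zero_le abs_combPieceDiff_one_le abs_combPieceUp_le abs_combPieceZero_le)
open Summit.QuantumFields.BalabanUV.Beta.GAN24.ContactRefineP (abs_pairing_refine_le)
open Summit.QuantumFields.BalabanUV.Beta.GAN24.ContactRefinePTent (tentDiff_letters_of_unitTent)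
open Summit.QuantumFields.BalabanUV.Beta.GAN24.CombContactRefinePWeights (sum_weights_twospike_geometric_left_le sum_weights_twospike_geometric_right_le)

namespace Summit.QuantumFields.BalabanUV.Beta.GAN24.CombContactRefinePThree

variable {Lc : ℕ} [NeZero Lc]

section Param

variable {κ₀ C c θ Φ₀ F : ℝ} {r rr : Fin (3 + 1) → ℕ}

/-- NOT IN PRINT; OUR BOOKKEEPING.  **THE (III′) P-ATOM DIFFERENCED ACROSS TWO TOWERS, PARAMETRIC IN THE LETTERS AT ONE RATE** (`d = 3`, `2 ≤ Lc`, in-block roots `r, rr`, face letter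
`F ≥ faceWtSum r Lc`; road-P2's `abs_pairing_refine_le` fed with MY `(k+3)`∕`(k+2)`-staircases and the two-spike weight rows). -/
theorem abs_pairingAtom_refine_le (hLc : 2 ≤ Lc) (hr : r ∈ box (3 + 1) Lc) (hrr : rr ∈ box (3 + 1) Lc) (hF : faceWtSum r Lc ≤ F) (hκ : 0 < κ₀) (hC : 0 ≤ C)
    (hc : 0 ≤ c) (hθ0 : 0 ≤ θ) (hΦ : 0 ≤ Φ₀)
    (hN1 : ∀ (m k : ℕ) (μ : Fin (3 + 1)) (z : Site (3 + 1)) (l'' : Fin (3 + 1)) (w' : Site (3 + 1)),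
      |respStep (d := 3) (Lc ^ m) (Lc ^ (m + k + 1)) μ z l'' w'| ≤
        C * ((Lc : ℝ) ^ (5 * (k + 1)))⁻¹ * Real.exp (-(κ₀ * supNorm (quo (Lc ^ (k + 1)) w' - z))))
    (hCau : ∀ (s k : ℕ) (μ : Fin (3 + 1)) (z : Site (3 + 1)) (l : Fin (3 + 1)) (w : Site (3 + 1)),
      |respStep (d := 3) (Lc ^ (s + 1)) (Lc ^ (s + k + 2)) μ z l w - respStep (d := 3) (Lc ^ s) (Lc ^ (s + k + 1)) μ z l w|
        ≤ c * θ ^ (s + k) * ((((Lc ^ (k + 1) : ℕ) : ℝ)) ^ (3 + 2))⁻¹ * Real.exp (-(κ₀ * supNorm (quo (Lc ^ (k + 1)) w - z))))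
    (hΦenv : ∀ (k : ℕ) (μ : Fin (3 + 1)) (z : Site (3 + 1)) (κ : Fin (3 + 1)) (y : Site (3 + 1)),
      |wΦ (N := Lc ^ (k + 1)) κ μ (y - z)| ≤ Φ₀ * ((Lc : ℝ) ^ (8 * (k + 1)))⁻¹ * Real.exp (-(κ₀ * supNorm (y - z))))
    (ht : ∀ (k : ℕ) (μ : Fin (3 + 1)) (z : Site (3 + 1)) (κ : Fin (3 + 1)) (u : Site (3 + 1)),
      |contourSumAdj (Lc ^ (k + 1)) (fun κ y => wΦ (N := Lc ^ (k + 1)) κ μ (y - z)) κ u|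
        ≤ (Lc ^ (k + 1) : ℕ) * (Φ₀ * ((Lc : ℝ) ^ (8 * (k + 1)))⁻¹) * Real.exp κ₀ * Real.exp (-(κ₀ * supNorm (quo (Lc ^ (k + 1)) u - z))))
    (k : ℕ) {ε : ℝ} (μt : Fin (3 + 1)) (zt : Site (3 + 1))
    (hTd : ∀ (κ' : Fin (3 + 1)) (y : Site (3 + 1)),
      |(((Lc : ℝ) ^ (k + 2)) ^ (2 * (3 + 1))) * wΦ (N := Lc ^ (k + 2)) κ' μt (y - zt)
          - (((Lc : ℝ) ^ (k + 1)) ^ (2 * (3 + 1))) * wΦ (N := Lc ^ (k + 1)) κ' μt (y - zt)| ≤ ε * Real.exp (-(κ₀ * supNorm (y - zt))))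
    (μ₁ : Fin (3 + 1)) (z₁ : Site (3 + 1)) (μ₂ : Fin (3 + 1)) (z₂ : Site (3 + 1)) {θ₀ θ₁ : ℝ} (hθr : |θ₀| + |θ₁| ≤ 1) (κ : Fin (3 + 1)) :
    |(∑' v : Site (3 + 1), contourSumAdj (Lc ^ (k + 2)) (fun κ' y => wΦ (N := Lc ^ (k + 2)) κ' μt (y - zt)) κ v
          * (θ₀ * (Psi (toSite rr) Lc 0 (k + 1) (delta1 μ₁ z₁) v + PsiFace r (toSite rr) Lc 0 (k + 1) (delta1 μ₁ z₁) v - bmGaugeAt (toSite rr) (respStep (d := 3) 1 (Lc ^ (k + 2)) μ₁ z₁) Lc v)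
            + θ₁ * (Psi (toSite rr) Lc 0 (k + 1) (delta1 μ₁ z₁) (v + unitVec κ) + PsiFace r (toSite rr) Lc 0 (k + 1) (delta1 μ₁ z₁) (v + unitVec κ) - bmGaugeAt (toSite rr) (respStep (d := 3) 1 (Lc ^ (k + 2)) μ₁ z₁) Lc (v + unitVec κ)))
          * ((Psi (toSite rr) Lc 0 (k + 1) (delta1 μ₂ z₂) (v + unitVec κ) + PsiFace r (toSite rr) Lc 0 (k + 1) (delta1 μ₂ z₂) (v + unitVec κ) - bmGaugeAt (toSite rr) (respStep (d := 3) 1 (Lc ^ (k + 2)) μ₂ z₂) Lc (v + unitVec κ))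
            - (Psi (toSite rr) Lc 0 (k + 1) (delta1 μ₂ z₂) v + PsiFace r (toSite rr) Lc 0 (k + 1) (delta1 μ₂ z₂) v - bmGaugeAt (toSite rr) (respStep (d := 3) 1 (Lc ^ (k + 2)) μ₂ z₂) Lc v)))
        - ((Lc : ℝ) ^ 12)⁻¹ * ∑' w : Site (3 + 1), contourSumAdj (Lc ^ (k + 1)) (fun κ' y => wΦ (N := Lc ^ (k + 1)) κ' μt (y - zt)) κ w
          * (θ₀ * (Psi (toSite rr) Lc 0 k (delta1 μ₁ z₁) w + PsiFace r (toSite rr) Lc 0 k (delta1 μ₁ z₁) w - bmGaugeAt (toSite rr) (respStep (d := 3) 1 (Lc ^ (k + 1)) μ₁ z₁) Lc w)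
            + θ₁ * (Psi (toSite rr) Lc 0 k (delta1 μ₁ z₁) (w + unitVec κ) + PsiFace r (toSite rr) Lc 0 k (delta1 μ₁ z₁) (w + unitVec κ) - bmGaugeAt (toSite rr) (respStep (d := 3) 1 (Lc ^ (k + 1)) μ₁ z₁) Lc (w + unitVec κ)))
          * ((Psi (toSite rr) Lc 0 k (delta1 μ₂ z₂) (w + unitVec κ) + PsiFace r (toSite rr) Lc 0 k (delta1 μ₂ z₂) (w + unitVec κ) - bmGaugeAt (toSite rr) (respStep (d := 3) 1 (Lc ^ (k + 1)) μ₂ z₂) Lc (w + unitVec κ))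
            - (Psi (toSite rr) Lc 0 k (delta1 μ₂ z₂) w + PsiFace r (toSite rr) Lc 0 k (delta1 μ₂ z₂) w - bmGaugeAt (toSite rr) (respStep (d := 3) 1 (Lc ^ (k + 1)) μ₂ z₂) Lc w))|
      ≤ ((((((k + 2 : ℕ) : ℝ)) + 1) * (2 * Real.exp (2 * κ₀) * (((Lc ^ (k + 2) : ℕ) : ℝ) * (Φ₀ * ((Lc : ℝ) ^ (8 * (k + 2)))⁻¹) * Real.exp κ₀) * ((8 * (Lc : ℝ) * C + F * (1 + 8 * (Lc : ℝ) * (Real.exp κ₀ + 1)) * C) * ((Lc : ℝ) ^ (5 * (k + 2)))⁻¹) * ((8 * (Lc : ℝ) * C + F * (1 + 8 * (Lc : ℝ) * (Real.exp κ₀ + 1)) * C) * ((Lc : ℝ) ^ (5 * (k + 2)))⁻¹)) + ((((k + 2 : ℕ) : ℝ)) + 1) * (2 * Real.exp (5 * κ₀) * ((Φ₀ * ((Lc : ℝ) ^ (8 * (k + 2)))⁻¹) + (((Lc ^ (k + 2) : ℕ) : ℝ) * (Φ₀ * ((Lc : ℝ) ^ (8 * (k + 2)))⁻¹) * Real.exp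 κ₀)) * ((8 * (Lc : ℝ) * C + F * (1 + 8 * (Lc : ℝ) * (Real.exp κ₀ + 1)) * C) * ((Lc : ℝ) ^ (5 * (k + 2)))⁻¹) * ((8 * (Lc : ℝ) * C + F * (1 + 8 * (Lc : ℝ) * (Real.exp κ₀ + 1)) * C) * ((Lc : ℝ) ^ (5 * (k + 2)))⁻¹))
          + 8 * Real.exp (5 * κ₀) * ((8 * (Lc : ℝ) + F * (1 + 8 * (Lc : ℝ) * (Real.exp κ₀ + 1))) * (c * θ ^ k) * ((Lc : ℝ) ^ (5 * (k + 2)))⁻¹) * ((8 * (Lc : ℝ) * C + F * (1 + 8 * (Lc : ℝ) * (Real.exp κ₀ + 1)) * C) * ((Lc : ℝ) ^ (5 * (k + 2)))⁻¹) * (Lc : ℝ) ^ (k + 2) * (2 * (((Lc ^ (k + 2) : ℕ) : ℝ) * (Φ₀ * ((Lc : ℝ) ^ (8 * (k + 2)))⁻¹) * Real.exp κ₀) + (Φ₀ * ((Lc : ℝ) ^ (8 * (k + 2)))⁻¹) * (Lc : ℝ) ^ (k + 2)))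
        + (2 * Real.exp (5 * κ₀) * ((8 * (Lc : ℝ) * C + F * (1 + 8 * (Lc : ℝ) * (Real.exp κ₀ + 1)) * C) * ((Lc : ℝ) ^ (5 * (k + 2)))⁻¹) * ((8 * (Lc : ℝ) * C + F * (1 + 8 * (Lc : ℝ) * (Real.exp κ₀ + 1)) * C) * ((Lc : ℝ) ^ (5 * (k + 2)))⁻¹) * (((((k + 2 : ℕ) : ℝ)) + 1) * (((Lc ^ (k + 2) : ℕ) : ℝ) * (Φ₀ * ((Lc : ℝ) ^ (8 * (k + 2)))⁻¹) * Real.exp κ₀) + 2 * (Φ₀ * ((Lc : ℝ) ^ (8 * (k + 2)))⁻¹) * (Lc : ℝ) ^ (k + 2))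
          + 2 * Real.exp (5 * κ₀) * ((8 * (Lc : ℝ) * C + F * (1 + 8 * (Lc : ℝ) * (Real.exp κ₀ + 1)) * C) * ((Lc : ℝ) ^ (5 * (k + 2)))⁻¹) * ((8 * (Lc : ℝ) * C + F * (1 + 8 * (Lc : ℝ) * (Real.exp κ₀ + 1)) * C) * ((Lc : ℝ) ^ (5 * (k + 2)))⁻¹) * (((((k + 2 : ℕ) : ℝ)) + 1) * (((Lc ^ (k + 2) : ℕ) : ℝ) * (Φ₀ * ((Lc : ℝ) ^ (8 * (k + 2)))⁻¹) * Real.exp κ₀) + 2 * (Φ₀ * ((Lc : ℝ) ^ (8 * (k + 2)))⁻¹) * (Lc : ℝ) ^ (k + 2))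
          + 8 * Real.exp (5 * κ₀) * ((8 * (Lc : ℝ) * C + F * (1 + 8 * (Lc : ℝ) * (Real.exp κ₀ + 1)) * C) * ((Lc : ℝ) ^ (5 * (k + 2)))⁻¹) * ((8 * (Lc : ℝ) + F * (1 + 8 * (Lc : ℝ) * (Real.exp κ₀ + 1))) * (c * θ ^ k) * ((Lc : ℝ) ^ (5 * (k + 2)))⁻¹) * (Lc : ℝ) ^ (k + 2) * (2 * (((Lc ^ (k + 2) : ℕ) : ℝ) * (Φ₀ * ((Lc : ℝ) ^ (8 * (k + 2)))⁻¹) * Real.exp κ₀) + (Φ₀ * ((Lc : ℝ) ^ (8 * (k + 2)))⁻¹) * (Lc : ℝ) ^ (k + 2)))) *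
          (∑' v : Site (3 + 1), Real.exp (-(κ₀ * supNorm (quo (Lc ^ (k + 2)) v - zt))) * Real.exp (-(κ₀ * supNorm (quo (Lc ^ (k + 2)) v - z₁))) *
            Real.exp (-(κ₀ * supNorm (quo (Lc ^ (k + 2)) v - z₂))))
        + (8 * Real.exp (5 * κ₀) * ((8 * (Lc : ℝ) * C + F * (1 + 8 * (Lc : ℝ) * (Real.exp κ₀ + 1)) * C) * ((Lc : ℝ) ^ (5 * (k + 1)))⁻¹) * ((8 * (Lc : ℝ) * C + F * (1 + 8 * (Lc : ℝ) * (Real.exp κ₀ + 1)) * C) * ((Lc : ℝ) ^ (5 * (k + 1)))⁻¹) * (Lc : ℝ) ^ (k + 1) * (2 * (((Lc ^ (k + 1) : ℕ) : ℝ) * (ε * ((Lc : ℝ) ^ 4 * ((Lc : ℝ) ^ (k + 2)) ^ 8)⁻¹) * Real.exp κ₀) + (ε * ((Lc : ℝ) ^ 4 * ((Lc : ℝ) ^ (k + 2)) ^ 8)⁻¹) * (Lc : ℝ) ^ (k + 1))) *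
          (∑' w : Site (3 + 1), Real.exp (-(κ₀ * supNorm (quo (Lc ^ (k + 1)) w - zt))) * Real.exp (-(κ₀ * supNorm (quo (Lc ^ (k + 1)) w - z₁))) *
            Real.exp (-(κ₀ * supNorm (quo (Lc ^ (k + 1)) w - z₂)))) := by
  haveI : NeZero (Lc ^ (k + 1)) := ⟨pow_ne_zero _ (NeZero.ne Lc)⟩
  haveI : NeZero (Lc ^ (k + 2)) := ⟨pow_ne_zero _ (NeZero.ne Lc)⟩
  have hL1 : 1 ≤ Lc := by omega
  have hL0 : (0 : ℝ) < (Lc : ℝ) := by exact_mod_cast (show 0 < Lc by omega)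
  have hN1' : 1 ≤ Lc ^ (k + 1) := Nat.one_le_pow _ _ (by omega)
  have hN2' : 1 ≤ Lc ^ (k + 2) := Nat.one_le_pow _ _ (by omega)
  have eN : Lc * Lc ^ (k + 1) = Lc ^ (k + 2) := by ring
  have hε : 0 ≤ ε := by
    have h := hTd 0 zt
    exact le_of_mul_le_mul_right ((zero_mul _).le.trans_eq (by ring) |>.trans ((abs_nonneg _).trans h)) (Real.exp_pos _)
  -- names of the letters
  have hF0 : 0 ≤ F := (faceWtSum_nonneg r Lc).trans hF
  set αP : ℝ := ((8 * (Lc : ℝ) * C + F * (1 + 8 * (Lc : ℝ) * (Real.exp κ₀ + 1)) * C) * ((Lc : ℝ) ^ (5 * (k + 2)))⁻¹) with hαP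
  set αCθ : ℝ := ((8 * (Lc : ℝ) + F * (1 + 8 * (Lc : ℝ) * (Real.exp κ₀ + 1))) * (c * θ ^ k) * ((Lc : ℝ) ^ (5 * (k + 2)))⁻¹) with hαCθ
  set a00 : ℝ := (8 * (Lc : ℝ) * C * ((Lc : ℝ) ^ (5 * (k + 2)))⁻¹) with ha00
  set a11 : ℝ := (8 * (Lc : ℝ) * (c * θ ^ k) * ((Lc : ℝ) ^ (5 * (k + 2)))⁻¹ * (Lc : ℝ) ^ 1 + F * ((1 + 8 * (Lc : ℝ) * (Real.exp κ₀ + 1)) * C * ((Lc : ℝ) ^ (5 * (k + 2)))⁻¹)) with ha11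
  set Φ₂ : ℝ := (Φ₀ * ((Lc : ℝ) ^ (8 * (k + 2)))⁻¹) with hΦ₂
  set τ₂ : ℝ := (((Lc ^ (k + 2) : ℕ) : ℝ) * (Φ₀ * ((Lc : ℝ) ^ (8 * (k + 2)))⁻¹) * Real.exp κ₀) with hτ₂
  set α₀ : ℝ := ((8 * (Lc : ℝ) * C + F * (1 + 8 * (Lc : ℝ) * (Real.exp κ₀ + 1)) * C) * ((Lc : ℝ) ^ (5 * (k + 1)))⁻¹) with hα₀
  set Φt : ℝ := (ε * ((Lc : ℝ) ^ 4 * ((Lc : ℝ) ^ (k + 2)) ^ 8)⁻¹) with hΦt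
  set τt : ℝ := (((Lc ^ (k + 1) : ℕ) : ℝ) * (ε * ((Lc : ℝ) ^ 4 * ((Lc : ℝ) ^ (k + 2)) ^ 8)⁻¹) * Real.exp κ₀) with hτt
  have hαP0 : 0 ≤ αP := by positivity
  have hαCθ0 : 0 ≤ αCθ := by positivity
  have ha000 : 0 ≤ a00 := by positivity
  have ha110 : 0 ≤ a11 := by positivity
  have hΦ₂0 : 0 ≤ Φ₂ := by positivity
  have hτ₂0 : 0 ≤ τ₂ := by positivity
  have hα₀0 : 0 ≤ α₀ := by positivity
  have hΦt0 : 0 ≤ Φt := by positivity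
  have hτt0 : 0 ≤ τt := by positivity
  -- the letter functions of the four fine′ staircases and the two coarse ones
  set aΔ : ℕ → ℝ := fun s => if s = 0 then a00 else if s = 1 then a11 else αCθ * (Lc : ℝ) ^ s with haΔ
  set aG : ℕ → ℝ := fun s => αP * (Lc : ℝ) ^ s with haG
  set a0 : ℕ → ℝ := fun s => α₀ * (Lc : ℝ) ^ s with ha0
  have haΔ0 : ∀ s, 0 ≤ aΔ s := fun s => by simp only [haΔ]; split_ifs <;> positivity
  have haG0 : ∀ s, 0 ≤ aG s := fun s => by positivity
  have ha0' : ∀ s, 0 ≤ a0 s := fun s => by positivity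
  have haΔL : ∀ s, aΔ s ≤ (if s = 0 then αP else 0) + (if s = 1 then αP else 0) + αCθ * (Lc : ℝ) ^ s := by
    intro s
    have hN50 : 0 ≤ ((Lc : ℝ) ^ (5 * (k + 2)))⁻¹ := by positivity
    have hc10 : 0 ≤ (1 + 8 * (Lc : ℝ) * (Real.exp κ₀ + 1)) := by positivity
    have hFC : 0 ≤ F * (1 + 8 * (Lc : ℝ) * (Real.exp κ₀ + 1)) * C * ((Lc : ℝ) ^ (5 * (k + 2)))⁻¹ := by positivity
    have hLC : 0 ≤ 8 * (Lc : ℝ) * C * ((Lc : ℝ) ^ (5 * (k + 2)))⁻¹ := by positivity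
    have hFθ : 0 ≤ F * (1 + 8 * (Lc : ℝ) * (Real.exp κ₀ + 1)) * (c * θ ^ k) * ((Lc : ℝ) ^ (5 * (k + 2)))⁻¹ * (Lc : ℝ) := by positivity
    have eP : αP = 8 * (Lc : ℝ) * C * ((Lc : ℝ) ^ (5 * (k + 2)))⁻¹ + F * (1 + 8 * (Lc : ℝ) * (Real.exp κ₀ + 1)) * C * ((Lc : ℝ) ^ (5 * (k + 2)))⁻¹ := by
      rw [hαP]; ring
    by_cases h0 : s = 0
    · subst h0
      have e : aΔ 0 = a00 := by simp [haΔ]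
      rw [e, if_pos rfl, if_neg (by norm_num : (0 : ℕ) ≠ 1), pow_zero, mul_one, add_zero, ha00]
      linarith
    · by_cases h1 : s = 1
      · subst h1
        have e : aΔ 1 = a11 := by simp [haΔ]
        have e1 : αCθ * (Lc : ℝ) ^ 1 = 8 * (Lc : ℝ) * (c * θ ^ k) * ((Lc : ℝ) ^ (5 * (k + 2)))⁻¹ * (Lc : ℝ) ^ 1
            + F * (1 + 8 * (Lc : ℝ) * (Real.exp κ₀ + 1)) * (c * θ ^ k) * ((Lc : ℝ) ^ (5 * (k + 2)))⁻¹ * (Lc : ℝ) := by rw [hαCθ, pow_one]; ring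
        have e2 : a11 = 8 * (Lc : ℝ) * (c * θ ^ k) * ((Lc : ℝ) ^ (5 * (k + 2)))⁻¹ * (Lc : ℝ) ^ 1
            + F * (1 + 8 * (Lc : ℝ) * (Real.exp κ₀ + 1)) * C * ((Lc : ℝ) ^ (5 * (k + 2)))⁻¹ := by rw [ha11]; ring
        rw [e, if_neg (by norm_num : (1 : ℕ) ≠ 0), if_pos rfl, zero_add, e1, e2, eP]
        linarith
      · have e : aΔ s = αCθ * (Lc : ℝ) ^ s := by simp [haΔ, h0, h1]
        rw [e, if_neg h0, if_neg h1, zero_add, zero_add]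
  have haGL : ∀ s, aG s ≤ αP * (Lc : ℝ) ^ s := fun s => le_rfl
  have ha0L : ∀ s, a0 s ≤ α₀ * (Lc : ℝ) ^ s := fun s => le_rfl
  -- divisibility
  have hdvd' : ∀ s, s ≤ k + 1 + 1 → Lc ^ s ∣ Lc * Lc ^ (k + 1) := fun s hs => by rw [eN]; exact pow_dvd_pow Lc (by omega)
  have hdvd : ∀ s, s ≤ k + 1 → Lc ^ s ∣ Lc ^ (k + 1) := fun s hs => pow_dvd_pow Lc (by omega)
  -- the quo bridge `Lc·Lc^(k+1) = Lc^(k+2)` for the fine′ envelopes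
  have hq : ∀ (u' c₀ : Site (3 + 1)), Real.exp (-(κ₀ * supNorm (quo (Lc * Lc ^ (k + 1)) u' - c₀))) = Real.exp (-(κ₀ * supNorm (quo (Lc ^ (k + 2)) u' - c₀))) := by
    intro u' c₀; rw [eN]
  -- (1) tent letters of the taller tower (I1 at height k+2)
  have hφ' : ∀ (κ' : Fin (3 + 1)) (y : Site (3 + 1)),
      |(fun κ' y => wΦ (N := Lc ^ (k + 2)) κ' μt (y - zt)) κ' y| ≤ Φ₂ * Real.exp (-(κ₀ * supNorm (y - zt))) :=
    fun κ' y => hΦenv (k + 1) μt zt κ' y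
  have ht' : ∀ (κ' : Fin (3 + 1)) (u' : Site (3 + 1)),
      |contourSumAdj (Lc * Lc ^ (k + 1)) (fun κ' y => wΦ (N := Lc ^ (k + 2)) κ' μt (y - zt)) κ' u'|
        ≤ τ₂ * Real.exp (-(κ₀ * supNorm (quo (Lc * Lc ^ (k + 1)) u' - zt))) := by
    intro κ' u'
    rw [eN]
    exact ht (k + 1) μt zt κ' u'
  -- (2) the third bracket's letters (CT-4d) and the shorter tower's tent
  obtain ⟨hφt, htt⟩ := tentDiff_letters_of_unitTent (Lc := Lc) hκ.le k μt zt hTd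
  have ht0 : ∀ (κ' : Fin (3 + 1)) (w : Site (3 + 1)),
      |contourSumAdj (Lc ^ (k + 1)) (fun κ' y => wΦ (N := Lc ^ (k + 1)) κ' μt (y - zt)) κ' w|
        ≤ ((((Lc ^ (k + 1) : ℕ) : ℝ)) * (Φ₀ * ((Lc : ℝ) ^ (8 * (k + 1)))⁻¹) * Real.exp κ₀) * Real.exp (-(κ₀ * supNorm (quo (Lc ^ (k + 1)) w - zt))) :=
    fun κ' w => ht k μt zt κ' w
  -- (3) the four fine′ staircases: identities and letters
  have hΔψ := fun (v : Site (3 + 1)) => combGauge_refine_eq_staircase (Lc := Lc) (d := 3) r (toSite rr) k μ₁ z₁ v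
  have hΔχ := fun (v : Site (3 + 1)) => combGauge_refine_eq_staircase (Lc := Lc) (d := 3) r (toSite rr) k μ₂ z₂ v
  have hψup := fun (v : Site (3 + 1)) => combGauge_coarse_eq_staircase_fine (Lc := Lc) (d := 3) r (toSite rr) k μ₁ z₁ v
  have hχ' : ∀ v : Site (3 + 1), (Psi (toSite rr) Lc 0 (k + 1) (delta1 μ₂ z₂) v + PsiFace r (toSite rr) Lc 0 (k + 1) (delta1 μ₂ z₂) v
        - bmGaugeAt (toSite rr) (respStep (d := 3) 1 (Lc ^ (k + 2)) μ₂ z₂) Lc v)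
      = ∑ s ∈ Finset.range (k + 1 + 2), (fun (s : ℕ) (y : Site (3 + 1)) =>
          (if s ≤ k + 1 then
              -(((Lc : ℝ) ^ ((3 + 1) * s))⁻¹ * bmGaugeAt (toSite rr) (legAct (respStep (d := 3) (Lc ^ s) (Lc ^ (k + 2))) (delta1 μ₂ z₂)) Lc y)
             else 0)
            + (if s = 0 then (0 : ℝ)
               else ((Lc : ℝ) ^ ((3 + 1) * (s - 1)))⁻¹ * ((((box (3 + 1) Lc).card : ℝ))⁻¹ *
                 zetaS (toSite r) Lc (legAct (legChain (respStepBmSeq (d := 3) (toSite rr) Lc) (s - 1) (k + 1 - (s - 1))) (delta1 μ₂ z₂)) y))) s (blk (Lc ^ s) v) := by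
    intro v
    have h := combGauge_eq_staircase_zero (Lc := Lc) (d := 3) r (toSite rr) (k + 1) μ₂ z₂ v
    rw [show k + 1 + 1 = k + 2 from rfl] at h
    exact h
  have hGΔ : ∀ (μ : Fin (3 + 1)) (z : Site (3 + 1)) (s : ℕ), s ≤ k + 1 + 1 → ∀ u' : Site (3 + 1),
      |(fun (s' : ℕ) (y : Site (3 + 1)) =>
          (if s' ≤ k + 1 then
            (if s' = 0 then -bmGaugeAt (toSite rr) (legAct (respStep (d := 3) 1 (Lc ^ (k + 2))) (delta1 μ z)) Lc y
             else -(((Lc : ℝ) ^ ((3 + 1) * s'))⁻¹ *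
               bmGaugeAt (toSite rr) (legAct (respStep (d := 3) (Lc ^ s') (Lc ^ (k + 2))) (delta1 μ z)
                 - legAct (respStep (d := 3) (Lc ^ (s' - 1)) (Lc ^ (k + 1))) (delta1 μ z)) Lc y))
           else 0)
          + (if s' = 0 then (0 : ℝ)
             else if s' = 1 then (((box (3 + 1) Lc).card : ℝ))⁻¹ * zetaS (toSite r) Lc (legAct (legChain (respStepBmSeq (d := 3) (toSite rr) Lc) 0 (k + 1)) (delta1 μ z)) y
             else ((Lc : ℝ) ^ ((3 + 1) * (s' - 1)))⁻¹ * ((((box (3 + 1) Lc).card : ℝ))⁻¹ *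
               (zetaS (toSite r) Lc (legAct (legChain (respStepBmSeq (d := 3) (toSite rr) Lc) (s' - 1) (k + 2 - s')) (delta1 μ z)) y
                - zetaS (toSite r) Lc (legAct (legChain (respStepBmSeq (d := 3) (toSite rr) Lc) (s' - 2) (k + 2 - s')) (delta1 μ z)) y))))
          s (blk (Lc ^ s) u')|
        ≤ aΔ s * Real.exp (-(κ₀ * supNorm (quo (Lc * Lc ^ (k + 1)) u' - z))) := by
    intro μ z s hs u'
    rw [hq]
    rcases Nat.lt_or_ge s 2 with hlt | hge
    · interval_cases s
      · have h := abs_combPieceDiff_zero_le (Lc := Lc) hN1 hrr (r := r) k μ z u'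
        simp only [haΔ, ↓reduceIte] at h ⊢
        exact h
      · have h := abs_combPieceDiff_one_le (Lc := Lc) hκ.le hC hN1 hCau hr hrr hF k μ z u'
        simp only [haΔ, one_ne_zero, ↓reduceIte] at h ⊢
        refine h.trans (le_of_eq ?_)
        rw [ha11]; ring
    · have h := abs_combPieceDiff_le (Lc := Lc) hκ.le hc hθ0 hCau hr hrr hF k μ z hge (by omega) u'
      have hne : s ≠ 0 := by omega
      have hne1 : s ≠ 1 := by omega
      simp only [haΔ, if_neg hne, if_neg hne1] at h ⊢
      exact h
  have hGup : ∀ (μ : Fin (3 + 1)) (z : Site (3 + 1)) (s : ℕ), s ≤ k + 1 + 1 → ∀ u' : Site (3 + 1),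
      |(fun (s' : ℕ) (y : Site (3 + 1)) =>
          (if s' = 0 then (0 : ℝ)
           else if s' ≤ k + 1 then
             -(((Lc : ℝ) ^ ((3 + 1) * s'))⁻¹ *
               bmGaugeAt (toSite rr) (legAct (respStep (d := 3) (Lc ^ (s' - 1)) (Lc ^ (k + 1))) (delta1 μ z)) Lc y)
           else 0)
          + (if s' ≤ 1 then (0 : ℝ)
             else ((Lc : ℝ) ^ ((3 + 1) * (s' - 1)))⁻¹ * ((((box (3 + 1) Lc).card : ℝ))⁻¹ *
               zetaS (toSite r) Lc (legAct (legChain (respStepBmSeq (d := 3) (toSite rr) Lc) (s' - 2) (k + 2 - s')) (delta1 μ z)) y)))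
          s (blk (Lc ^ s) u')|
        ≤ aG s * Real.exp (-(κ₀ * supNorm (quo (Lc * Lc ^ (k + 1)) u' - z))) := by
    intro μ z s hs u'
    rw [hq]
    exact abs_combPieceUp_le (Lc := Lc) hκ.le hC hN1 hr hrr hF k μ z (by omega) u'
  have hG' : ∀ (μ : Fin (3 + 1)) (z : Site (3 + 1)) (s : ℕ), s ≤ k + 1 + 1 → ∀ u' : Site (3 + 1),
      |(fun (s : ℕ) (y : Site (3 + 1)) =>
          (if s ≤ k + 1 then
              -(((Lc : ℝ) ^ ((3 + 1) * s))⁻¹ * bmGaugeAt (toSite rr) (legAct (respStep (d := 3) (Lc ^ s) (Lc ^ (k + 2))) (delta1 μ z)) Lc y)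
             else 0)
            + (if s = 0 then (0 : ℝ)
               else ((Lc : ℝ) ^ ((3 + 1) * (s - 1)))⁻¹ * ((((box (3 + 1) Lc).card : ℝ))⁻¹ *
                 zetaS (toSite r) Lc (legAct (legChain (respStepBmSeq (d := 3) (toSite rr) Lc) (s - 1) (k + 1 - (s - 1))) (delta1 μ z)) y))) s (blk (Lc ^ s) u')|
        ≤ aG s * Real.exp (-(κ₀ * supNorm (quo (Lc * Lc ^ (k + 1)) u' - z))) := by
    intro μ z s hs u'
    rw [hq]
    have h := abs_combPieceZero_le (Lc := Lc) hκ.le hC hN1 hr hrr hF (k + 1) μ z (show s ≤ k + 1 + 1 by omega) u'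
    rw [show k + 1 + 1 = k + 2 from rfl] at h
    exact h
  -- (4) the two coarse staircases
  have hψ := fun (w : Site (3 + 1)) => combGauge_eq_staircase_zero (Lc := Lc) (d := 3) r (toSite rr) k μ₁ z₁ w
  have hχ := fun (w : Site (3 + 1)) => combGauge_eq_staircase_zero (Lc := Lc) (d := 3) r (toSite rr) k μ₂ z₂ w
  have hG : ∀ (μ : Fin (3 + 1)) (z : Site (3 + 1)) (s : ℕ), s ≤ k + 1 → ∀ w : Site (3 + 1),
      |(fun (s : ℕ) (y : Site (3 + 1)) =>
          (if s ≤ k then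
              -(((Lc : ℝ) ^ ((3 + 1) * s))⁻¹ * bmGaugeAt (toSite rr) (legAct (respStep (d := 3) (Lc ^ s) (Lc ^ (k + 1))) (delta1 μ z)) Lc y)
             else 0)
            + (if s = 0 then (0 : ℝ)
               else ((Lc : ℝ) ^ ((3 + 1) * (s - 1)))⁻¹ * ((((box (3 + 1) Lc).card : ℝ))⁻¹ *
                 zetaS (toSite r) Lc (legAct (legChain (respStepBmSeq (d := 3) (toSite rr) Lc) (s - 1) (k - (s - 1))) (delta1 μ z)) y))) s (blk (Lc ^ s) w)|
        ≤ a0 s * Real.exp (-(κ₀ * supNorm (quo (Lc ^ (k + 1)) w - z))) :=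
    fun μ z s hs w => abs_combPieceZero_le (Lc := Lc) hκ.le hC hN1 hr hrr hF k μ z hs w
  -- (5) the summable envelope classes
  have hE' := (tsum_env3_le (d := 3) (L := Lc * Lc ^ (k + 1)) (by rw [eN]; exact hN2') hκ zt z₁ z₂).1
  have hE := (tsum_env3_le (d := 3) (L := Lc ^ (k + 1)) hN1' hκ zt z₁ z₂).1
  -- (6) the schema
  have h := abs_pairing_refine_le (d := 3) (P := Lc) (N := Lc ^ (k + 1)) (k := k + 1) (κ₀ := κ₀)
    (φ' := fun κ' y => wΦ (N := Lc ^ (k + 2)) κ' μt (y - zt)) (φ := fun κ' y => wΦ (N := Lc ^ (k + 1)) κ' μt (y - zt))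
    (ψ' := fun v => Psi (toSite rr) Lc 0 (k + 1) (delta1 μ₁ z₁) v + PsiFace r (toSite rr) Lc 0 (k + 1) (delta1 μ₁ z₁) v - bmGaugeAt (toSite rr) (respStep (d := 3) 1 (Lc ^ (k + 2)) μ₁ z₁) Lc v)
    (χ' := fun v => Psi (toSite rr) Lc 0 (k + 1) (delta1 μ₂ z₂) v + PsiFace r (toSite rr) Lc 0 (k + 1) (delta1 μ₂ z₂) v - bmGaugeAt (toSite rr) (respStep (d := 3) 1 (Lc ^ (k + 2)) μ₂ z₂) Lc v)
    (ψ := fun w => Psi (toSite rr) Lc 0 k (delta1 μ₁ z₁) w + PsiFace r (toSite rr) Lc 0 k (delta1 μ₁ z₁) w - bmGaugeAt (toSite rr) (respStep (d := 3) 1 (Lc ^ (k + 1)) μ₁ z₁) Lc w)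
    (χ := fun w => Psi (toSite rr) Lc 0 k (delta1 μ₂ z₂) w + PsiFace r (toSite rr) Lc 0 k (delta1 μ₂ z₂) w - bmGaugeAt (toSite rr) (respStep (d := 3) 1 (Lc ^ (k + 1)) μ₂ z₂) Lc w)
    (cψ := ((Lc : ℝ) ^ (3 + 1))⁻¹) (cχ := ((Lc : ℝ) ^ (3 + 1))⁻¹) (c₀ := ((Lc : ℝ) ^ 12)⁻¹)
    (ΔG₁ := (fun (s' : ℕ) (y : Site (3 + 1)) => (if s' ≤ k + 1 then (if s' = 0 then -bmGaugeAt (toSite rr) (legAct (respStep (d := 3) 1 (Lc ^ (k + 2))) (delta1 μ₁ z₁)) Lc y else -(((Lc : ℝ) ^ ((3 + 1) * s'))⁻¹ * bmGaugeAt (toSite rr) (legAct (respStep (d := 3) (Lc ^ s') (Lc ^ (k + 2))) (delta1 μ₁ z₁) - legAct (respStep (d := 3) (Lc ^ (s' - 1)) (Lc ^ (k + 1))) (delta1 μ₁ z₁)) Lc y)) else 0) + (if s' = 0 then (0 : ℝ) else if s' = 1 then (((box (3 + 1) Lc).card : ℝ))⁻¹ * zetaS (toSite r) Lc (legAct (legChain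 (respStepBmSeq (d := 3) (toSite rr) Lc) 0 (k + 1)) (delta1 μ₁ z₁)) y else ((Lc : ℝ) ^ ((3 + 1) * (s' - 1)))⁻¹ * ((((box (3 + 1) Lc).card : ℝ))⁻¹ * (zetaS (toSite r) Lc (legAct (legChain (respStepBmSeq (d := 3) (toSite rr) Lc) (s' - 1) (k + 2 - s')) (delta1 μ₁ z₁)) y - zetaS (toSite r) Lc (legAct (legChain (respStepBmSeq (d := 3) (toSite rr) Lc) (s' - 2) (k + 2 - s')) (delta1 μ₁ z₁)) y)))))
    (Gup₁ := (fun (s' : ℕ) (y : Site (3 + 1)) => (if s' = 0 then (0 : ℝ) else if s' ≤ k + 1 then -(((Lc : ℝ) ^ ((3 + 1) * s'))⁻¹ * bmGaugeAt (toSite rr) (legAct (respStep (d := 3) (Lc ^ (s' - 1)) (Lc ^ (k + 1))) (delta1 μ₁ z₁)) Lc y) else 0) + (if s' ≤ 1 then (0 : ℝ) else ((Lc : ℝ) ^ ((3 + 1) * (s' - 1)))⁻¹ * ((((box (3 + 1) Lc).card : ℝ))⁻¹ * zetaS (toSite r) Lc (legAct (legChain (respStepBmSeq (d := 3) (toSite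 rr) Lc) (s' - 2) (k + 2 - s')) (delta1 μ₁ z₁)) y))))
    (G₂' := (fun (s : ℕ) (y : Site (3 + 1)) => (if s ≤ k + 1 then -(((Lc : ℝ) ^ ((3 + 1) * s))⁻¹ * bmGaugeAt (toSite rr) (legAct (respStep (d := 3) (Lc ^ s) (Lc ^ (k + 2))) (delta1 μ₂ z₂)) Lc y) else 0) + (if s = 0 then (0 : ℝ) else ((Lc : ℝ) ^ ((3 + 1) * (s - 1)))⁻¹ * ((((box (3 + 1) Lc).card : ℝ))⁻¹ * zetaS (toSite r) Lc (legAct (legChain (respStepBmSeq (d := 3) (toSite rr) Lc) (s - 1) (k + 1 - (s - 1))) (delta1 μ₂ z₂)) y))))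
    (ΔG₂ := (fun (s' : ℕ) (y : Site (3 + 1)) => (if s' ≤ k + 1 then (if s' = 0 then -bmGaugeAt (toSite rr) (legAct (respStep (d := 3) 1 (Lc ^ (k + 2))) (delta1 μ₂ z₂)) Lc y else -(((Lc : ℝ) ^ ((3 + 1) * s'))⁻¹ * bmGaugeAt (toSite rr) (legAct (respStep (d := 3) (Lc ^ s') (Lc ^ (k + 2))) (delta1 μ₂ z₂) - legAct (respStep (d := 3) (Lc ^ (s' - 1)) (Lc ^ (k + 1))) (delta1 μ₂ z₂)) Lc y)) else 0) + (if s' = 0 then (0 : ℝ) else if s' = 1 then (((box (3 + 1) Lc).card : ℝ))⁻¹ * zetaS (toSite r) Lc (legAct (legChain (respStepBmSeq (d := 3) (toSite rr) Lc) 0 (k + 1)) (delta1 μ₂ z₂)) y else ((Lc : ℝ) ^ ((3 + 1) * (s' - 1)))⁻¹ * ((((box (3 + 1) Lc).card : ℝ))⁻¹ * (zetaS (toSite r) Lc (legAct (legChain (respStepBmSeq (d := 3) (toSite rr) Lc) (s' - 1) (k + 2 - s')) (delta1 μ₂ z₂)) y - zetaS (toSite r) Lc (legAct (legChain (respStepBmSeq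 (d := 3) (toSite rr) Lc) (s' - 2) (k + 2 - s')) (delta1 μ₂ z₂)) y)))))
    (G₁ := (fun (s : ℕ) (y : Site (3 + 1)) => (if s ≤ k then -(((Lc : ℝ) ^ ((3 + 1) * s))⁻¹ * bmGaugeAt (toSite rr) (legAct (respStep (d := 3) (Lc ^ s) (Lc ^ (k + 1))) (delta1 μ₁ z₁)) Lc y) else 0) + (if s = 0 then (0 : ℝ) else ((Lc : ℝ) ^ ((3 + 1) * (s - 1)))⁻¹ * ((((box (3 + 1) Lc).card : ℝ))⁻¹ * zetaS (toSite r) Lc (legAct (legChain (respStepBmSeq (d := 3) (toSite rr) Lc) (s - 1) (k - (s - 1))) (delta1 μ₁ z₁)) y))))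
    (G₂ := (fun (s : ℕ) (y : Site (3 + 1)) => (if s ≤ k then -(((Lc : ℝ) ^ ((3 + 1) * s))⁻¹ * bmGaugeAt (toSite rr) (legAct (respStep (d := 3) (Lc ^ s) (Lc ^ (k + 1))) (delta1 μ₂ z₂)) Lc y) else 0) + (if s = 0 then (0 : ℝ) else ((Lc : ℝ) ^ ((3 + 1) * (s - 1)))⁻¹ * ((((box (3 + 1) Lc).card : ℝ))⁻¹ * zetaS (toSite r) Lc (legAct (legChain (respStepBmSeq (d := 3) (toSite rr) Lc) (s - 1) (k - (s - 1))) (delta1 μ₂ z₂)) y))))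
    (aΔ := aΔ) (aup := aG) (b' := aG) (bΔ := aΔ) (a := a0) (b := a0)
    hκ.le hτ₂0 hΦ₂0 (by positivity) (by positivity) hL1 hθr haΔ0 haG0 haG0 haΔ0 ha0' ha0' hdvd' hdvd hφ' ht' hφt htt ht0
    hΔψ (hGΔ μ₁ z₁) hψup (hGup μ₁ z₁) hχ' (hG' μ₂ z₂) hΔχ (hGΔ μ₂ z₂) hψ (hG μ₁ z₁) hχ (hG μ₂ z₂) hE' hE κ
  rw [eN] at h
  refine h.trans ?_
  -- (7) the weights
  have hW1 := sum_weights_twospike_geometric_left_le (K := k + 2) (Lc := Lc) (κ₀ := κ₀) (τ := τ₂) (Φ₀ := Φ₂) hκ.le hτ₂0 hΦ₂0 hLc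
    hαP0 hαP0 hαCθ0 hαP0 haΔ0 haG0 haΔL haGL
  have hW2 := sum_weights_twospike_geometric_right_le (K := k + 2) (Lc := Lc) (κ₀ := κ₀) (τ := τ₂) (Φ₀ := Φ₂) hκ.le hτ₂0 hΦ₂0 hLc
    hαP0 hαP0 hαP0 hαCθ0 haG0 haΔ0 haGL haΔL
  have hW3 := sum_weights_le_of_geometric (k := k + 1) (Lc := Lc) (κ₀ := κ₀) (τ := τt) (Φ₀ := Φt) hLc hκ.le hτt0 hΦt0 hα₀0 hα₀0 ha0' ha0' ha0L ha0L
  have hS'0 : 0 ≤ ∑' v : Site (3 + 1), Real.exp (-(κ₀ * supNorm (quo (Lc ^ (k + 2)) v - zt))) * Real.exp (-(κ₀ * supNorm (quo (Lc ^ (k + 2)) v - z₁))) *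
      Real.exp (-(κ₀ * supNorm (quo (Lc ^ (k + 2)) v - z₂))) := tsum_nonneg fun v => by positivity
  have hS0 : 0 ≤ ∑' w : Site (3 + 1), Real.exp (-(κ₀ * supNorm (quo (Lc ^ (k + 1)) w - zt))) * Real.exp (-(κ₀ * supNorm (quo (Lc ^ (k + 1)) w - z₁))) *
      Real.exp (-(κ₀ * supNorm (quo (Lc ^ (k + 1)) w - z₂))) := tsum_nonneg fun w => by positivity
  rw [← add_mul]
  refine add_le_add (mul_le_mul_of_nonneg_right ?_ hS'0) (mul_le_mul_of_nonneg_right ?_ hS0)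
  · exact (add_le_add hW1 hW2).trans (le_of_eq rfl)
  · exact hW3.trans (le_of_eq rfl)

end Param

end Summit.QuantumFields.BalabanUV.Beta.GAN24.CombContactRefinePThree

end
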